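import Summits.ResolutionOfSingularities.ResolutionOfSingularities.Theorems.MarkedTransferCampaignW31GuardedHalves
import Literature.AlgebraicGeometry.Hironaka2017.Proofs.S06BaseHike.Thm6p1
import HarnessLib

/-!
# [OURS · L1 W3.1] The LIVE RESIDUAL of R12/12a after slot W3.1, BY NAME: ⟨StableTower⟩ — `CampaignW31.HatStableTowerPos`
# (guarded, binder shape of ⟨StableCut⟩) and its `p`-slice; the split ⟨StableCut⟩ = ⟨closedness⟩ ∧ ⟨StableTower⟩; and the
# kernel fact that MODULO W3.1 the residual is EXACT: `U30_2_R2_inst ↔ HatStableTowerPos`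

Cell `res-hironaka`, rung L, slot W3.1 aftercare (OURS typer o4, statement-only lane). The G3 lead's GAP-AMEND of record for
R12 key 12a (res-adj-3, STATUS 2026-08-27T01:18Z «MODULUS RESTATED on res-type-010's EVIDENCE R12 #5»): the modulus of the
(43)-existence sentence (`S06BaseHike.U30_2_R2_inst`, row 010d; EXISTENCE OF `Ě` NOT SHOWN IN PRINT) is
P := ⟨UscCut ∧ StableTower⟩ = «closure Σ_max ∩ Sing(Ê)_cl = Σ_max ∧ ∃ b₀ > 0, StableAt Ê Σ̄_max b₀», equivalent per `(E, ed)` to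
the conclusion (`Lib/CoreFocusTower.exists_isCoreFocus_iff_closure_ambient`, p480139; `Proofs/S06BaseHike/U30L4c.U30_2_R2_inst_iff`,
p479791), and «LIVE RESIDUAL after R13: ⟨StableTower⟩ at Σ̄_max». The companion file p480937 (`…W31GuardedHalves.lean`) named the
conjunction `CampaignW31.HatStableCutPos` (= res-type-010's binder `hR12_StableCut` verbatim) and its first conjunct
`CampaignW31.HatStratumClosedPos` (delivered by slot W3.1 unconditionally in the slot's terms, `hatStratumClosedPos_of_invmaxClosed`).
This file names the SECOND conjunct alone — the part NOT covered by W3.1 — so that the GAP-LEDGER cell, RESCUE-SEED §7's P-row and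
the D-lane's §M label «R12:StableTower» can cite one declaration:

* OURS defs (desk lanes): `CampaignW31.HatStableTowerPos IsEdgeData A n` — for every standard `E` with `0 < Ê.b` and every
  certified family `ed` of edge data of `Ê = baseHike E` on `Sing(Ê)_cl`, res-type-010's tower of candidates
  `b ↦ focusAt Ê Σ̄_max b` over the closure `Σ̄_max = invmaxClosure (Sing(Ê)_cl) (invField Ê ed)` of the `Inv_max`-stratum is
  STABLE at some positive level (`S06BaseHike.StableAt`, `Lib/CoreFocusCandidates`); `p`-slice `CampaignW31HatStableTowerPosI p`
  at row 005 part b's provenance.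
* Kernel plumbing (pure logic over the typed carriers, nothing of the manuscript): the split
  `HatStableCutPos ↔ HatStratumClosedPos ∧ HatStableTowerPos` (`hatStableCutPos_iff_closedPos_and_towerPos`); the doors
  `HatClosureRegularPos ⇒ HatClosureOrdPowPos ⇒ HatStableTowerPos` (level `1`); sufficiency
  `HatStratumClosedPos ∧ HatStableTowerPos ⇒ U30_2_R2_inst`, hence FROM W3.1: `CampaignW31InvmaxClosed ∧ HatStableTowerPos ⇒
  U30_2_R2_inst`; NECESSITY per `(E, ed)` under `U30_2_R2_inst`'s own guards (`stableTower_of_U30_2_R2_inst`, a projection of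
  res-type-010's `U30_2_R2_inst_iff`); and, with the guard «`Inv_max` attained» discharged by W3.1's `CampaignW31.InvmaxAttained`
  and «`Sing(E)_cl ≠ ∅`» by `0 < Ê.b` (`baseHike_sing_inter_closedPoints_nonempty`), the EXACTNESS statements
  `U30_2_R2_inst_iff_hatStableTowerPos_of_invmaxClosed` (parametric) / `U30_2_R2_inst_iff_stableTowerPosI_of_invmaxClosedI`,
  `…_of_uscInvOneExponentI` (`p`-slices): GIVEN SLOT W3.1, the R12/12a apex `U30_2_R2_inst` holds at every ambient datum IFF
  ⟨StableTower⟩ does — no OURS statement weaker than ⟨StableTower⟩ closes 12a, and none stronger is needed.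

HONEST FRAMING. Everything here is OURS (theorems about OUR typed definitions; `U30_2_R2_inst`, `IsCoreFocus`, `StableAt`,
`focusAt`, `baseHike`, `invField` are the S-typers' / res-type-010's typings and constructions for §6.1–6.2 p.29–30). NOTHING below
is a statement of H. Hironaka's manuscript *Resolution of singularities in positive characteristics* (2017-03-23, [Hironaka2017],
lit key `paper:url-3343fd9e678b`), which prints no argument for the existence of `Ě` (p.30 l.4–9) and never forms `Σ̄_max` or a
tower; nothing of it is asserted; it stays «under review». `HatStableTowerPos` is a CANDIDATE premise: no argument either way is on
record for the `Σ̄_max` of an actual `Ê`. VACUITY SELF-CHECK (T-lint): not trivially true — it is the live residual itself (informal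
gloss by res-type-010, labelled informal: a finite-generation-type property of the symbolic-power algebra of `Σ̄_max` up to
𝔖-equivalence, which fails for Roberts/Nagata-type curves; whether such a `Σ̄_max` occurs is OPEN, res-adj-3 01:18Z); not
trivially false — implied at level `1` by `HatClosureOrdPowPos` / `HatClosureRegularPos`, and TRUE at level `2` on RESCUE-SEED W3.6
specimen (B) modulo Inv-constancy (res-type-010 `SpecimenB.specimenB_isCoreFocus`, p484139); vacuous exactly where no certified
edge-data family exists (as every `Hat…` decl; existence = the typed candidate `S04CharAlgebra.Rem4_10_exists`, not asserted); the
guard `0 < Ê.b` excludes only row 009's documented junk value `Ê = (J, 0)`. AI bookkeeping; weaker than expert review.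

## References (context; nothing below is used as a premise)
* H. Hironaka, ms. 2017-03-23, §6.1 p.29 l.17–19 (`Ê`), §6.2 p.30 l.4–9, Eq. (43) — scope only, under adjudication. [Hironaka2017]
* Cell records: res-adj-3 GAP-AMEND R12 KEY 12a (STATUS 2026-08-27T01:18Z); res-type-010 EVIDENCE R12 #5 (p478949, p479433/p480139,
  p479791) and `SpecimenB` p484139; o4 p476257 / p480089 / p480937; res-L1-k31 p467881 (`…W31UscAssembly.lean`).
-/

noncomputable section

set_option linter.dupNamespace false -- mandated namespace of this single-conjunct summit

open _root_.AlgebraicGeometry _root_.TopologicalSpace _root_.CategoryTheory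

namespace Summit.ResolutionOfSingularities.ResolutionOfSingularities.Theorems

open Literature.AlgebraicGeometry.Resolution
open Literature.AlgebraicGeometry.Hironaka2017
open Literature.AlgebraicGeometry.Hironaka2017.S02Preliminaries
open Literature.AlgebraicGeometry.Hironaka2017.S04CharAlgebra
open Literature.AlgebraicGeometry.Hironaka2017.S06BaseHike
open Literature.AlgebraicGeometry.Hironaka2017.Datum

universe u

namespace CampaignW31

/-! ## Plumbing on any scheme: `0 < Ê.b` forces closed singular points of `E` and of `Ê` -/

section AnyScheme

variable {Z : Scheme.{u}}

/-- `Sing(E)_cl ≠ ∅` when `0 < (baseHike E).b` (the typed supremum `baseHikeOrder E` over an empty index set is `0`).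
[folklore] -/
private theorem sing_inter_closedPoints_nonempty_of_baseHike_b_pos (E : IdealExponent Z) (hb : 0 < (baseHike E).b) :
    (E.sing ∩ S02Preliminaries.closedPoints Z).Nonempty := by
  -- adapted from Literature/AlgebraicGeometry/Hironaka2017/Proofs/S06BaseHike/Thm614PosNegative.lean
  by_contra h
  rw [Set.not_nonempty_iff_eq_empty] at h
  have h0 : baseHikeOrder E = 0 := by
    unfold baseHikeOrder
    rw [h]
    simp
  have : (baseHike E).b = 0 := by
    change (baseHikeOrder E).toNat = 0
    rw [h0]; rfl
  omega

/-- **`Sing(Ê)_cl ≠ ∅` whenever `0 < Ê.b`** (`Ê = baseHike E`, any scheme `Z`): then `Sing(E)_cl ≠ ∅`, the supremum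
`d̂ = baseHikeOrder E` of `ord_ξ(J)` over `Sing(E)_cl` is finite (`coe_baseHike_b_of_pos`, Thm6p1) and attained at a closed `ξ`
(finite suprema in `ℕ∞` are attained), and that `ξ` lies in `Sing(Ê) = {ord ≥ d̂}`. Pure order theory over the typed carriers
of rows 001/009; this is the non-emptiness guard of `S06BaseHike.U30_2_R2_inst` / `CampaignW31.InvmaxAttained` read off the
guard `0 < Ê.b`. [folklore] -/
theorem baseHike_sing_inter_closedPoints_nonempty (E : IdealExponent Z) (hb : 0 < (baseHike E).b) :
    ((baseHike E).sing ∩ S02Preliminaries.closedPoints Z).Nonempty := by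
  -- adapted from Literature/AlgebraicGeometry/Hironaka2017/Proofs/S15ARSchemes/Thm15p9CoreFocus.lean (first case)
  have hne := sing_inter_closedPoints_nonempty_of_baseHike_b_pos E hb
  haveI : Nonempty ↥(E.sing ∩ S02Preliminaries.closedPoints Z) := hne.to_subtype
  have hcoe : ((baseHike E).b : ℕ∞) = baseHikeOrder E := coe_baseHike_b_of_pos E hb
  have hsup : baseHikeOrder E = ⨆ x : ↥(E.sing ∩ S02Preliminaries.closedPoints Z), idealOrder E.J x.1 := by
    unfold baseHikeOrder
    rw [iSup_subtype']
  obtain ⟨⟨ξ, hξS⟩, hξ⟩ := ENat.exists_eq_iSup_of_lt_top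
    (f := fun x : ↥(E.sing ∩ S02Preliminaries.closedPoints Z) => idealOrder E.J x.1)
    (by rw [← hsup, ← hcoe]; exact ENat.coe_lt_top _)
  refine ⟨ξ, ?_, hξS.2⟩
  show ((baseHike E).b : ℕ∞) ≤ idealOrder E.J ξ
  rw [hcoe, hsup, ← hξ]

end AnyScheme

/-! ## The residual ⟨StableTower⟩, guarded, in the binder shape of ⟨StableCut⟩ (`HatStableCutPos`, p480937) -/

section Hat

variable (IsEdgeData : ∀ ⦃X : Scheme.{u}⦄ ⦃p n : ℕ⦄ (E : IdealExponent X) (ξ : X), EdgeDatumAt p n E ξ → Prop)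

/-- **[OURS · L1 W3.1] `CampaignW31.HatStableTowerPos` — THE LIVE RESIDUAL ⟨StableTower⟩ of R12/12a after slot W3.1, GUARDED**:
replaces the role of NOTHING printed (the manuscript gives no argument for the existence of `Ě`, §6.2 p.30 l.4–9, and forms
neither the closure `Σ̄_max` of the `Inv_max`-stratum nor a tower); NOT a statement of the manuscript. Binders of
`CampaignW31.HatStableCutPos IsEdgeData A n` (= res-type-010's ⟨StableCut⟩, `U30L4c`): for every standard `E` on `A.Z` with
`0 < Ê.b` (`Ê = baseHike E`) and every certified family `ed` of edge data of `Ê` on `Sing(Ê)_cl`, the tower of candidates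
`b ↦ focusAt Ê Σ̄_max b` over `Σ̄_max = invmaxClosure (Sing(Ê)_cl) (invField Ê ed)` is stable at SOME positive level `b₀`
(`S06BaseHike.StableAt`). It is the SECOND conjunct of `HatStableCutPos` (`hatStableCutPos_iff_closedPos_and_towerPos`); the
first is W3.1's delivery. MODULO W3.1 it is EQUIVALENT to the R12/12a apex `U30_2_R2_inst IsEdgeData A n`
(`U30_2_R2_inst_iff_hatStableTowerPos_of_invmaxClosed`). CANDIDATE premise; implied at level `1` by `HatClosureOrdPowPos`
(hence by `HatClosureRegularPos`). [folklore] -/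
def HatStableTowerPos {p : ℕ} [Fact p.Prime] {K : Type u} [Field K] [CharP K p] [PerfectField K]
    (A : AmbientDatum p K) (n : ℕ) : Prop :=
  ∀ (E : IdealExponent A.Z) (ed : EdgeDataOn p n (baseHike E)), E.IsStandard → 0 < (baseHike E).b →
    IsEdgeDataOn IsEdgeData (baseHike E) ed →
      ∃ b₀ : ℕ, 0 < b₀ ∧ StableAt (baseHike E)
        (invmaxClosure ((baseHike E).sing ∩ S02Preliminaries.closedPoints A.Z) (invField (baseHike E) ed)) b₀

variable {IsEdgeData}

/-- ⟨StableCut⟩ contains ⟨StableTower⟩ (its second conjunct). [folklore] -/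
theorem hatStableTowerPos_of_hatStableCutPos {p : ℕ} [Fact p.Prime] {K : Type u} [Field K] [CharP K p]
    [PerfectField K] {A : AmbientDatum p K} {n : ℕ} (h : HatStableCutPos IsEdgeData A n) :
    HatStableTowerPos IsEdgeData A n :=
  fun E ed hE hb hed => (h E ed hE hb hed).2

/-- ⟨closedness⟩ ∧ ⟨StableTower⟩ ⇒ ⟨StableCut⟩ (the cut equation from p476257's `invmaxClosure_inter_eq`). [folklore] -/
theorem hatStableCutPos_of_closedPos_of_towerPos {p : ℕ} [Fact p.Prime] {K : Type u} [Field K] [CharP K p]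
    [PerfectField K] {A : AmbientDatum p K} {n : ℕ} (h₁ : HatStratumClosedPos IsEdgeData A n)
    (h₂ : HatStableTowerPos IsEdgeData A n) : HatStableCutPos IsEdgeData A n :=
  fun E ed hE hb hed => ⟨invmaxClosure_inter_eq (h₁ E ed hE hb hed), h₂ E ed hE hb hed⟩

/-- **THE SPLIT**: ⟨StableCut⟩ ↔ ⟨closedness⟩ ∧ ⟨StableTower⟩ — res-adj-3's P = ⟨UscCut ∧ StableTower⟩ as the conjunction of
W3.1's delivered half and the live residual. [folklore] -/
theorem hatStableCutPos_iff_closedPos_and_towerPos {p : ℕ} [Fact p.Prime] {K : Type u} [Field K] [CharP K p]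
    [PerfectField K] {A : AmbientDatum p K} {n : ℕ} :
    HatStableCutPos IsEdgeData A n ↔ HatStratumClosedPos IsEdgeData A n ∧ HatStableTowerPos IsEdgeData A n :=
  ⟨fun h => ⟨hatStratumClosedPos_of_hatStableCutPos h, hatStableTowerPos_of_hatStableCutPos h⟩,
    fun h => hatStableCutPos_of_closedPos_of_towerPos h.1 h.2⟩

/-- **ORD-POW door ⇒ ⟨StableTower⟩ at level `1`** (p480089/p480937's `stableAt_one_of_closed_of_ordPow`, i.e. res-type-010's
`stableAt_one_of_diffPower_le_pow`). [folklore] -/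
theorem hatStableTowerPos_of_hatClosureOrdPowPos {p : ℕ} [Fact p.Prime] {K : Type u} [Field K] [CharP K p]
    [PerfectField K] {A : AmbientDatum p K} {n : ℕ} (h : HatClosureOrdPowPos IsEdgeData A n) :
    HatStableTowerPos IsEdgeData A n :=
  fun E ed hE hb hed => ⟨1, Nat.one_pos, stableAt_one_of_closed_of_ordPow A E ed hb (h E ed hE hb hed)⟩

/-- **REGULAR door ⇒ ⟨StableTower⟩** (through the ORD-POW door). [folklore] -/
theorem hatStableTowerPos_of_hatClosureRegularPos {p : ℕ} [Fact p.Prime] {K : Type u} [Field K] [CharP K p]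
    [PerfectField K] {A : AmbientDatum p K} {n : ℕ} (h : HatClosureRegularPos IsEdgeData A n) :
    HatStableTowerPos IsEdgeData A n :=
  hatStableTowerPos_of_hatClosureOrdPowPos (hatClosureOrdPowPos_of_hatClosureRegularPos h)

/-- **Sufficiency**: ⟨closedness⟩ ∧ ⟨StableTower⟩ ⇒ the R12/12a apex `U30_2_R2_inst` (res-type-010's `U30_2_R2_inst_of_stableCut`
by name, p480937). [folklore] -/
theorem U30_2_R2_inst_of_closedPos_and_towerPos {p : ℕ} [Fact p.Prime] {K : Type u} [Field K] [CharP K p]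
    [PerfectField K] {A : AmbientDatum p K} {n : ℕ} (h₁ : HatStratumClosedPos IsEdgeData A n)
    (h₂ : HatStableTowerPos IsEdgeData A n) : U30_2_R2_inst IsEdgeData A n :=
  U30_2_R2_inst_of_hatStableCutPos (hatStableCutPos_of_closedPos_of_towerPos h₁ h₂)

/-- **Sufficiency FROM SLOT W3.1**: the slot's consequence statement `CampaignW31InvmaxClosed IsEdgeData` (p463247; from the slot
statement by res-L1-k31's `campaignW31InvmaxClosed_of_uscInvOneExponent`, p467881) plus ⟨StableTower⟩ give the R12/12a apex at
every ambient datum. [folklore] -/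
theorem U30_2_R2_inst_of_invmaxClosed_and_towerPos (hW31 : CampaignW31InvmaxClosed.{u} IsEdgeData) {p : ℕ} [Fact p.Prime]
    {K : Type u} [Field K] [CharP K p] [PerfectField K] {A : AmbientDatum p K} {n : ℕ}
    (h : HatStableTowerPos IsEdgeData A n) : U30_2_R2_inst IsEdgeData A n :=
  U30_2_R2_inst_of_closedPos_and_towerPos (hatStratumClosedPos_of_invmaxClosed hW31 K A n) h

/-! ### Necessity: the apex forces ⟨StableTower⟩ (res-type-010's `U30_2_R2_inst_iff`, projected) -/

/-- **Necessity per `(E, ed)`, under `U30_2_R2_inst`'s own guards**: if the typed (43)-existence sentence holds at `A`, then for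
every standard `E` with `Sing(E)_cl ≠ ∅`, `0 < Ê.b`, every certified `ed` with an ATTAINED `Inv_max`, the tower over `Σ̄_max` is
stable at a positive level (second conjunct of `U30L4c.U30_2_R2_inst_iff`). [folklore] -/
theorem stableTower_of_U30_2_R2_inst {p : ℕ} [Fact p.Prime] {K : Type u} [Field K] [CharP K p] [PerfectField K]
    {A : AmbientDatum p K} {n : ℕ} (h : U30_2_R2_inst IsEdgeData A n) (E : IdealExponent A.Z)
    (ed : EdgeDataOn p n (baseHike E)) (hE : E.IsStandard) (hne : (E.sing ∩ S02Preliminaries.closedPoints A.Z).Nonempty)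
    (hb : 0 < (baseHike E).b) (hed : IsEdgeDataOn IsEdgeData (baseHike E) ed)
    (hv : ∃ v : EdgeInv n,
      IsInvmax ((baseHike E).sing ∩ S02Preliminaries.closedPoints A.Z) (invField (baseHike E) ed) v) :
    ∃ b₀ : ℕ, 0 < b₀ ∧ StableAt (baseHike E)
      (invmaxClosure ((baseHike E).sing ∩ S02Preliminaries.closedPoints A.Z) (invField (baseHike E) ed)) b₀ :=
  ((U30_2_R2_inst_iff IsEdgeData A n).mp h E hE hne hb ed hed hv).2

/-- … and the first conjunct: the apex forces the `Inv_max`-stratum to be relatively closed (W3.1's half is also NECESSARY). [folklore] -/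
theorem stratumRelClosedOn_of_U30_2_R2_inst {p : ℕ} [Fact p.Prime] {K : Type u} [Field K] [CharP K p] [PerfectField K]
    {A : AmbientDatum p K} {n : ℕ} (h : U30_2_R2_inst IsEdgeData A n) (E : IdealExponent A.Z)
    (ed : EdgeDataOn p n (baseHike E)) (hE : E.IsStandard) (hne : (E.sing ∩ S02Preliminaries.closedPoints A.Z).Nonempty)
    (hb : 0 < (baseHike E).b) (hed : IsEdgeDataOn IsEdgeData (baseHike E) ed)
    (hv : ∃ v : EdgeInv n,
      IsInvmax ((baseHike E).sing ∩ S02Preliminaries.closedPoints A.Z) (invField (baseHike E) ed) v) :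
    StratumRelClosedOn ((baseHike E).sing ∩ S02Preliminaries.closedPoints A.Z) (invField (baseHike E) ed) :=
  ⟨_, isClosed_closure, ((U30_2_R2_inst_iff IsEdgeData A n).mp h E hE hne hb ed hed hv).1.symm⟩

/-- **The guard «`Inv_max` attained» from W3.1's `InvmaxAttained`** (slot file p463247), in row 010d's idiom: for a certified
family `ed` on `Sing(Ê)_cl` with `0 < Ê.b`, `Sing(Ê)_cl ≠ ∅` (`baseHike_sing_inter_closedPoints_nonempty`), so an attained maximum
of the selection `EdgeDataSelection.ofFamily ed hed` is an attained maximum of `invField Ê ed` (`selInv_eq_invField`). [folklore] -/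
theorem invmax_attained_of_invmaxAttained {p : ℕ} [Fact p.Prime] {K : Type u} [Field K] [CharP K p]
    {A : AmbientDatum p K} {n : ℕ} (E : IdealExponent A.Z) (ed : EdgeDataOn p n (baseHike E))
    (hb : 0 < (baseHike E).b) (hed : IsEdgeDataOn IsEdgeData (baseHike E) ed)
    (hatt : InvmaxAttained (EdgeDataSelection.ofFamily ed hed)) :
    ∃ v : EdgeInv n, IsInvmax ((baseHike E).sing ∩ S02Preliminaries.closedPoints A.Z) (invField (baseHike E) ed) v := by
  have h := hatt (baseHike_sing_inter_closedPoints_nonempty E hb)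
  rwa [selInv_eq_invField, EdgeDataSelection.ofFamily_D] at h

/-- **Necessity with the guards discharged**: if `Inv_max` is attained for every standard exponent and every selection at
`(A, n)` (W3.1's `InvmaxAttained`, first conjunct of `CampaignW31InvmaxClosed`), then the apex `U30_2_R2_inst IsEdgeData A n`
forces ⟨StableTower⟩ — `Sing(E)_cl ≠ ∅` comes free from `0 < Ê.b`. [folklore] -/
theorem hatStableTowerPos_of_U30_2_R2_inst {p : ℕ} [Fact p.Prime] {K : Type u} [Field K] [CharP K p] [PerfectField K]
    {A : AmbientDatum p K} {n : ℕ}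
    (hatt : ∀ F : IdealExponent A.Z, F.IsStandard → ∀ sel : EdgeDataSelection p n F IsEdgeData, InvmaxAttained sel)
    (h : U30_2_R2_inst IsEdgeData A n) : HatStableTowerPos IsEdgeData A n :=
  fun E ed hE hb hed =>
    stableTower_of_U30_2_R2_inst h E ed hE (sing_inter_closedPoints_nonempty_of_baseHike_b_pos E hb) hb hed
      (invmax_attained_of_invmaxAttained E ed hb hed (hatt (baseHike E) (isStandard_baseHike hE hb) _))

/-- **[OURS · L1 W3.1] EXACTNESS OF THE RESIDUAL, parametric**: GIVEN slot W3.1's consequence statement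
`CampaignW31InvmaxClosed IsEdgeData`, the R12/12a apex `U30_2_R2_inst IsEdgeData A n` holds IFF ⟨StableTower⟩
`HatStableTowerPos IsEdgeData A n` does. So, after W3.1, ⟨StableTower⟩ is not one sufficient condition among others but THE
residual: nothing weaker closes 12a at `(A, n)`, nothing stronger is needed. [folklore] -/
theorem U30_2_R2_inst_iff_hatStableTowerPos_of_invmaxClosed (hW31 : CampaignW31InvmaxClosed.{u} IsEdgeData) {p : ℕ}
    [Fact p.Prime] {K : Type u} [Field K] [CharP K p] [PerfectField K] {A : AmbientDatum p K} {n : ℕ} :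
    U30_2_R2_inst IsEdgeData A n ↔ HatStableTowerPos IsEdgeData A n :=
  ⟨hatStableTowerPos_of_U30_2_R2_inst fun F hF sel => (hW31 p K A n F hF sel).1,
    U30_2_R2_inst_of_invmaxClosed_and_towerPos hW31⟩

/-- … and in ⟨StableCut⟩'s terms: given W3.1, `U30_2_R2_inst ↔ HatStableCutPos`. [folklore] -/
theorem U30_2_R2_inst_iff_hatStableCutPos_of_invmaxClosed (hW31 : CampaignW31InvmaxClosed.{u} IsEdgeData) {p : ℕ}
    [Fact p.Prime] {K : Type u} [Field K] [CharP K p] [PerfectField K] {A : AmbientDatum p K} {n : ℕ} :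
    U30_2_R2_inst IsEdgeData A n ↔ HatStableCutPos IsEdgeData A n :=
  (U30_2_R2_inst_iff_hatStableTowerPos_of_invmaxClosed hW31).trans
    ⟨fun h => hatStableCutPos_of_closedPos_of_towerPos (hatStratumClosedPos_of_invmaxClosed hW31 K A n) h,
      hatStableTowerPos_of_hatStableCutPos⟩

end Hat

end CampaignW31

open CampaignW31

/-! ## Per-`p` slices at row 005 part b's provenance (parameter-free targets; pattern of p480937) -/

/-- **[OURS · L1 W3.1] `CampaignW31HatStableTowerPosI p`** — `p`-slice of the live residual ⟨StableTower⟩ at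
`CampaignW31.edgeDataProvenance`: for every perfect `K` of characteristic `p`, ambient datum `A`, `n`, standard `E` with `0 < Ê.b`
and certified edge-data family on `Sing(Ê)_cl`, res-type-010's tower over `Σ̄_max(Ê)` is stable at a positive level. Replaces the
role of nothing printed (no existence argument for `Ě`, p.30 l.4–9); CANDIDATE premise = §M label «R12:StableTower»; NOT a statement
of the manuscript. [folklore] -/
def CampaignW31HatStableTowerPosI (p : ℕ) [Fact p.Prime] : Prop :=
  ∀ (K : Type u) [Field K] [CharP K p] [PerfectField K] (A : AmbientDatum p K) (n : ℕ),
    HatStableTowerPos CampaignW31.edgeDataProvenance A n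

/-- THE SPLIT, `p`-slices: ⟨StableCut⟩ ↔ ⟨closedness⟩ ∧ ⟨StableTower⟩. [folklore] -/
theorem campaignW31HatStableCutPosI_iff_closed_and_tower (p : ℕ) [Fact p.Prime] :
    CampaignW31HatStableCutPosI.{u} p ↔ CampaignW31HatStratumClosedPosI.{u} p ∧ CampaignW31HatStableTowerPosI.{u} p :=
  ⟨fun h => ⟨fun K _ _ _ A n => hatStratumClosedPos_of_hatStableCutPos (h K A n),
      fun K _ _ _ A n => hatStableTowerPos_of_hatStableCutPos (h K A n)⟩,
    fun h K _ _ _ A n => hatStableCutPos_of_closedPos_of_towerPos (h.1 K A n) (h.2 K A n)⟩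

/-- ORD-POW door ⇒ ⟨StableTower⟩, `p`-slices. [folklore] -/
theorem campaignW31HatStableTowerPosI_of_hatClosureOrdPowPosI (p : ℕ) [Fact p.Prime]
    (h : CampaignW31HatClosureOrdPowPosI.{u} p) : CampaignW31HatStableTowerPosI.{u} p :=
  fun K _ _ _ A n => hatStableTowerPos_of_hatClosureOrdPowPos (h K A n)

/-- REGULAR door ⇒ ⟨StableTower⟩, `p`-slices. [folklore] -/
theorem campaignW31HatStableTowerPosI_of_hatClosureRegularPosI (p : ℕ) [Fact p.Prime]
    (h : CampaignW31HatClosureRegularPosI.{u} p) : CampaignW31HatStableTowerPosI.{u} p :=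
  fun K _ _ _ A n => hatStableTowerPos_of_hatClosureRegularPos (h K A n)

/-- **[OURS · L1 W3.1 → D-lane] existence of `Ě` FROM THE SLOT STATEMENT and ⟨StableTower⟩**:
`CampaignW31UscInvOneExponentI p → CampaignW31HatStableTowerPosI p → ∀ K A n, U30_2_R2_inst edgeDataProvenance A n`. [folklore] -/
theorem U30_2_R2_inst_of_usc_and_stableTowerPos (p : ℕ) [Fact p.Prime]
    (h₁ : CampaignW31UscInvOneExponentI.{u} p) (h₂ : CampaignW31HatStableTowerPosI.{u} p)
    (K : Type u) [Field K] [CharP K p] [PerfectField K] (A : AmbientDatum p K) (n : ℕ) :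
    U30_2_R2_inst CampaignW31.edgeDataProvenance A n :=
  U30_2_R2_inst_of_closedPos_and_towerPos (campaignW31HatStratumClosedPosI_of_uscInvOneExponentI p h₁ K A n) (h₂ K A n)

/-- … and from the consequence statement `CampaignW31InvmaxClosedI p`. [folklore] -/
theorem U30_2_R2_inst_of_invmaxClosedI_and_stableTowerPos (p : ℕ) [Fact p.Prime]
    (h₁ : CampaignW31InvmaxClosedI.{u} p) (h₂ : CampaignW31HatStableTowerPosI.{u} p)
    (K : Type u) [Field K] [CharP K p] [PerfectField K] (A : AmbientDatum p K) (n : ℕ) :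
    U30_2_R2_inst CampaignW31.edgeDataProvenance A n :=
  U30_2_R2_inst_of_closedPos_and_towerPos (campaignW31HatStratumClosedPosI_of_invmaxClosedI p h₁ K A n) (h₂ K A n)

/-- **[OURS · L1 W3.1] EXACTNESS OF THE RESIDUAL, `p`-slices**: GIVEN `CampaignW31InvmaxClosedI p`, the R12/12a apex at every
perfect `K` of characteristic `p`, every ambient datum and `n` holds IFF `CampaignW31HatStableTowerPosI p` does. [folklore] -/
theorem U30_2_R2_inst_iff_stableTowerPosI_of_invmaxClosedI (p : ℕ) [Fact p.Prime] (h : CampaignW31InvmaxClosedI.{u} p) :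
    (∀ (K : Type u) [Field K] [CharP K p] [PerfectField K] (A : AmbientDatum p K) (n : ℕ),
        U30_2_R2_inst CampaignW31.edgeDataProvenance A n) ↔
      CampaignW31HatStableTowerPosI.{u} p :=
  ⟨fun hU K _ _ _ A n => hatStableTowerPos_of_U30_2_R2_inst (fun F hF sel => (h K A n F hF sel).1) (hU K A n),
    fun hT K _ _ _ A n => U30_2_R2_inst_of_invmaxClosedI_and_stableTowerPos p h hT K A n⟩

/-- … and GIVEN THE SLOT STATEMENT `CampaignW31UscInvOneExponentI p` (res-L1-k31's assembly gives `CampaignW31InvmaxClosedI p`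
from it): the R12/12a apex for the prime `p` ↔ `CampaignW31HatStableTowerPosI p`. [folklore] -/
theorem U30_2_R2_inst_iff_stableTowerPosI_of_uscInvOneExponentI (p : ℕ) [Fact p.Prime]
    (h : CampaignW31UscInvOneExponentI.{u} p) :
    (∀ (K : Type u) [Field K] [CharP K p] [PerfectField K] (A : AmbientDatum p K) (n : ℕ),
        U30_2_R2_inst CampaignW31.edgeDataProvenance A n) ↔
      CampaignW31HatStableTowerPosI.{u} p :=
  U30_2_R2_inst_iff_stableTowerPosI_of_invmaxClosedI p (campaignW31InvmaxClosedI_of_uscInvOneExponentI p h)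

end Summit.ResolutionOfSingularities.ResolutionOfSingularities.Theorems

end
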